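import Mathlib
import HarnessLib
import Summits.HubbardSuperconductivity.HubbardSuperconductivity.Theorems.KLProgrammeKLRegimeFatMultiplierIncrementPairTime
import Summits.HubbardSuperconductivity.HubbardSuperconductivity.Theorems.KLProgrammeKLRegimeFatMultiplierIncrementPairData
import Summits.HubbardSuperconductivity.HubbardSuperconductivity.Theorems.KLProgrammeKLRegimeFatMultiplierIncrementRelJetsScaleData
import Summits.HubbardSuperconductivity.HubbardSuperconductivity.Theorems.KLProgrammeKLRegimeFatFrameInstance

/-!
# Route `KLProgramme` — crux K3 ENGINE (stmt-HubbardSuperconductivity-20437) stub (b) conj. 2 «(c-D)² FAMILY TELESCOPE», brick (D5b, time/sup): the fat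
# INCREMENT pair `(F̃^{K_o}_ω − F̃^K_ω)·F̃^K_{ω′}` — amplitude `𝔅₀(x)`, support count, tangency datum on the support, and time differences `≤ 𝔅₀(x)·θ_k`

Cell `gate-hubbard-kl`, seat hubbard-kl-k3c3-p2 (g11); F1-DESIGN §10.  The remaining multiplier data of `slicePairWt_charSum_l1_le_famIncrScale`
(`…SectorSlicePairFamIncrScale`) for the fat increment pair in the two-scale class of a flow piece at depth `x` (`|ν| ≤ G₀/x²`):
`bgmFatIncrPair_data` (p589533: sup, support inclusion/count, cell, tangency) and `norm_fwdDiff_iter_time_fatIncrPair_le` (p585374) ∘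
`incrPair_time_rel_le` (`…IncrementRelJetsScaleData`).

* **`bgmFatIncrPair_ampTime_data`** — (1) `‖Gs^Δ‖ ≤ 𝔅₀(x) = C₁·(G₀/x²)(2(Λ_m+G₀/x²)+G₀/x²)`; (2) support count `≤` the plain pair's bound;
  (3) on the support, `|De_K(c(q₂))·(2π/L)v| ≤ |2π/L|(4+2A) + K₂√2ρ_f‖(2π/L)v‖`; (4) time differences `≤ 𝔅₀(x)·θ_k`, `k = 1,2,3`, with
  `θ₁ = κD₁ᵗ + q₁ᵗ`, `θ₂ = κ²(D₁ᵗ)² + κD₂ᵗ + 2κD₁ᵗq₁ᵗ + q₂ᵗ`, `θ₃ = …` (`D₁ᵗ = 2Λ_m|2π/β|`, `D₂ᵗ = 2(2π/β)²`, `q_kᵗ` the profile's time jets; `x`-free).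

Everything is proved; no definitions, no sorry.  Nothing asserts superconductivity. [cite: BenfattoGiulianiMastropietro2006, §2.5 (2.46)–(2.56), §2.7 (2.66)–(2.71a), §3 (3.2)]
-/

noncomputable section

namespace Summit.HubbardSuperconductivity.HubbardSuperconductivity.Theorems.TorusFourierL2

set_option linter.dupNamespace false -- summit = problem name (single-conjunct summit), D-0017

open Set Finset Filter Topology Literature.MathematicalPhysics.QuantumLattice Literature.MathematicalPhysics.QuantumLattice.BandSectorCounting
open Literature.MathematicalPhysics.QuantumLattice.FermiRG Literature.Probability.LatticeModels Literature.Analysis.SpecialFunctions Literature.Analysis.Calculus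
open Summit.HubbardSuperconductivity.HubbardSuperconductivity.Theorems.DispersionFlow
open Summit.HubbardSuperconductivity.HubbardSuperconductivity.Theorems.KLRegimeSplit
open Summit.HubbardSuperconductivity.HubbardSuperconductivity.Theorems.KLProgrammeLegKernels
open Summit.HubbardSuperconductivity.HubbardSuperconductivity.Theorems.PerturbedFermiCurve
open scoped Real Nat

section AmpTime

open Classical

variable {L M : ℕ} [NeZero L] [NeZero M] {a b : ℝ} (B : BandBounds a b) {K : TrigPolyC4v} (Ko : TrigPolyC4v) {A : ℝ}
  (hA : ∀ p : Momentum, ∀ j ≤ 2, ‖iteratedFDeriv ℝ j (frameShift K) p‖ ≤ A) (hADt : 2 * A < B.Dtmin)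
  {μ e₀ z β : ℝ} (he : 0 < e₀) (hz : 0 < z) (hz1 : z ≤ 1) (hgap : e₀ + A + z ^ 2 < -μ) (h3 : e₀ + A - μ ≤ 3)
  (hlo : a ≤ μ - A - e₀) (hhi : μ + A + e₀ ≤ b) (hβ : 0 < β) (hρA : 4 * A < 2 * B.rhomin)
  (m : ℕ) (hMm : klScale e₀ m * β < π * (2 * M - 5))
  {d : ℝ} (hd : 0 ≤ d) (hd1 : ∀ u, |deriv (bgmCutoffSq e₀) u| ≤ d) (hd2 : ∀ u, |iteratedDeriv 2 (bgmCutoffSq e₀) u| ≤ d)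
  (hd3 : ∀ u, |iteratedDeriv 3 (bgmCutoffSq e₀) u| ≤ d) (hd4 : ∀ u, |iteratedDeriv 4 (bgmCutoffSq e₀) u| ≤ d)
  {K₂ : ℝ} (hK₂ : ∀ p, ‖iteratedFDeriv ℝ 2 (frameLevel μ K) p‖ ≤ K₂)
  -- the piece `ν = e_K − e_{K_o}` at depth `x`
  {ν : (Fin 2 → ℝ) → ℝ} (hν : ∀ p, ν p = frameLevel μ K (WithLp.toLp 2 p) - frameLevel μ Ko (WithLp.toLp 2 p))
  {x G₀ : ℝ} (hx : 1 ≤ x) (hN₀ : ∀ p, |ν p| ≤ G₀ / x ^ 2)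
  -- the names (instantiate with `rfl`)
  {ρf κ C₁ B₀x qt₁ qt₂ qt₃ Dt₁ Dt₂ θ₁ θ₂ θ₃ : ℝ}
  (hρf : ρf = (klScale e₀ m + B.smax * B.Dtmin * (3 * sectorWidth (m + 1) / 4)) / (B.Dtmin - 2 * A) +
    π * Real.sqrt 2 * (1 + (4 + 2 * A) / (B.Dtmin - 2 * A)) * sectorWidth (m + 1))
  (hκ : κ = e₀ ^ 2 / klScale e₀ m ^ 2) (hC₁ : C₁ = d * e₀ ^ 2 / klScale e₀ m ^ 2)
  (hB₀x : B₀x = C₁ * (G₀ / x ^ 2 * (2 * (klScale e₀ m + G₀ / x ^ 2) + G₀ / x ^ 2)))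
  (hqt₁ : qt₁ = 2 * (d * e₀ ^ 2) * |2 * π / β| / klScale e₀ m) (hqt₂ : qt₂ = (4 * (d * e₀ ^ 4) + 2 * (d * e₀ ^ 2)) * (2 * π / β) ^ 2 / klScale e₀ m ^ 2)
  (hqt₃ : qt₃ = (8 * (d * e₀ ^ 6) + 12 * (d * e₀ ^ 4)) * |2 * π / β| ^ 3 / klScale e₀ m ^ 3)
  (hDt₁ : Dt₁ = 2 * klScale e₀ m * |2 * π / β|) (hDt₂ : Dt₂ = 2 * (2 * π / β) ^ 2)
  (hθ₁ : θ₁ = κ * Dt₁ + qt₁) (hθ₂ : θ₂ = κ ^ 2 * Dt₁ ^ 2 + κ * Dt₂ + 2 * (κ * Dt₁) * qt₁ + qt₂)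
  (hθ₃ : θ₃ = κ ^ 3 * Dt₁ ^ 3 + 3 * (κ ^ 2 * (Dt₁ * Dt₂)) + 3 * ((κ ^ 2 * Dt₁ ^ 2 + κ * Dt₂) * qt₁) + 3 * (κ * Dt₁ * qt₂) + qt₃)

include B hA hADt he hz hz1 hgap h3 hlo hhi hβ hρA hMm hd hd1 hd2 hd3 hd4 hK₂ hν hx hN₀ hρf hκ hC₁ hB₀x hqt₁ hqt₂ hqt₃ hDt₁ hDt₂ hθ₁ hθ₂ hθ₃ in
set_option maxHeartbeats 3000000 in
/-- **Amplitude, support, tangency datum and time differences of the fat increment pair** (see the module docstring).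
[cite: BenfattoGiulianiMastropietro2006, §2.5 (2.46)–(2.56), §2.7 (2.66)–(2.71a), §3 (3.2)] -/
theorem bgmFatIncrPair_ampTime_data (ω ω' : Fin (sectorCount (m + 1))) (v : Fin 2 → ℤ)
    (hvtan : |fderiv ℝ (fun p : Fin 2 → ℝ => frameLevel μ K (WithLp.toLp 2 p)) (klFermiPoint μ K (sectorCenter (m + 1) (ω : ℕ)))
      (fun j => 2 * π / L * (v j : ℝ))| ≤ |2 * π / L| * (4 + 2 * A))
    (Gs : TorusSite 1 (2 * M) × TorusSite 2 L → ℂ)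
    (hGsdef : Gs = fun q => bgmFatMultiplier L M e₀ β (nambuXiCT L μ Ko) (m + 1) ω (⟨(q.1 0).val, ZMod.val_lt (q.1 0)⟩, q.2) *
        bgmFatMultiplier L M e₀ β (nambuXiCT L μ K) (m + 1) ω' (⟨(q.1 0).val, ZMod.val_lt (q.1 0)⟩, q.2) -
      bgmFatMultiplier L M e₀ β (nambuXiCT L μ K) (m + 1) ω (⟨(q.1 0).val, ZMod.val_lt (q.1 0)⟩, q.2) *
        bgmFatMultiplier L M e₀ β (nambuXiCT L μ K) (m + 1) ω' (⟨(q.1 0).val, ZMod.val_lt (q.1 0)⟩, q.2)) :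
    (∀ q, ‖Gs q‖ ≤ B₀x) ∧
    ((((univ.filter fun q => Gs q ≠ 0).card : ℕ) : ℝ) ≤
      (klScale e₀ m * β / π + 1) *
        ((Real.sqrt 2 * L * ((klScale e₀ m + (4 + 4 * A) * ρf ^ 2) / (2 * B.rhomin - 4 * A)) / π + 2) *
          (Real.sqrt 2 * L * (2 * ρf) / π + 2))) ∧
    (∀ q, Gs q ≠ 0 → |fderiv ℝ (frameLevel μ K) (WithLp.toLp 2 (torusCentredMomentum L q.2)) (WithLp.toLp 2 (fun i => 2 * π / L * (v i : ℝ)))| ≤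
      |2 * π / L| * (4 + 2 * A) + K₂ * (Real.sqrt 2 * ρf) * ‖(WithLp.toLp 2 (fun i => 2 * π / L * (v i : ℝ)) : EuclideanSpace ℝ (Fin 2))‖) ∧
    (∀ q, ‖fwdDiff ((fun _ : Fin 1 => (1 : ZMod (2 * M))), (0 : TorusSite 2 L)) Gs q‖ ≤ B₀x * θ₁) ∧
    (∀ q, ‖(fwdDiff ((fun _ : Fin 1 => (1 : ZMod (2 * M))), (0 : TorusSite 2 L)))^[2] Gs q‖ ≤ B₀x * θ₂) ∧
    (∀ q, ‖(fwdDiff ((fun _ : Fin 1 => (1 : ZMod (2 * M))), (0 : TorusSite 2 L)))^[3] Gs q‖ ≤ B₀x * θ₃) ∧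
    (0 ≤ θ₁ ∧ 0 ≤ θ₂ ∧ 0 ≤ θ₃) := by
  have hL : (0 : ℝ) < L := Nat.cast_pos.2 (Nat.pos_of_ne_zero (NeZero.ne L))
  have hπ := Real.pi_pos
  have hΛ : 0 < klScale e₀ m := by rw [klScale]; positivity
  have hA0 : 0 ≤ A := (norm_nonneg _).trans (hA 0 0 (by norm_num))
  have hx0 : 0 < x := lt_of_lt_of_le one_pos hx
  -- sup, support, cell, tangency from the data lemma (with `τ₀ = |2π/L|(4+2A)`)
  obtain ⟨hsup, -, hcount, -, hτE⟩ := bgmFatIncrPair_data B Ko hA hADt he hz hz1 hgap h3 hlo hhi hβ hρA m hd hd1 hd2 hd3 hK₂ hν hN₀ hρf ω ω' v hvtan Gs hGsdef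
  -- the objects for the time instance
  obtain ⟨S₁, hS₁⟩ : ∃ S₁ : Finset ℕ, S₁ = (range (sectorCount (m + 1))).filter
      (fun ω₁ : ℕ => ∃ δ : ℤ, |δ| ≤ 1 ∧ (sectorCount (m + 1) : ℤ) ∣ ((ω₁ : ℤ) - ((ω : ℕ) : ℤ) - δ)) := ⟨_, rfl⟩
  obtain ⟨S₂, hS₂⟩ : ∃ S₂ : Finset ℕ, S₂ = (range (sectorCount (m + 1))).filter
      (fun ω₁ : ℕ => ∃ δ : ℤ, |δ| ≤ 1 ∧ (sectorCount (m + 1) : ℤ) ∣ ((ω₁ : ℤ) - ((ω' : ℕ) : ℤ) - δ)) := ⟨_, rfl⟩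
  have hS₁r : S₁ ⊆ range (sectorCount (m + 1)) := by rw [hS₁]; exact fatNbr_subset_range (m + 1) ω
  have hS₂r : S₂ ⊆ range (sectorCount (m + 1)) := by rw [hS₂]; exact fatNbr_subset_range (m + 1) ω'
  obtain ⟨Z, hZdef⟩ : ∃ Z : (Fin 2 → ℝ) → ℝ, Z = fun p => gnCutoff ((π + z) ^ 2 / π ^ 2) ((π + z) ^ 2) (p 0 ^ 2) * gnCutoff ((π + z) ^ 2 / π ^ 2) ((π + z) ^ 2) (p 1 ^ 2) *
    ((radialCutoffC (1 / 2) (momToComplex p) * ∑ a' ∈ S₁, sectorWeightCirc (m + 1) ((a' : ℕ) : ℤ) (polarAngle p)) *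
      (radialCutoffC (1 / 2) (momToComplex p) * ∑ b' ∈ S₂, sectorWeightCirc (m + 1) ((b' : ℕ) : ℤ) (polarAngle p))) := ⟨_, rfl⟩
  have hZ : ∀ p, Z p = gnCutoff ((π + z) ^ 2 / π ^ 2) ((π + z) ^ 2) (p 0 ^ 2) * gnCutoff ((π + z) ^ 2 / π ^ 2) ((π + z) ^ 2) (p 1 ^ 2) *
    ((radialCutoffC (1 / 2) (momToComplex p) * ∑ a' ∈ S₁, sectorWeightCirc (m + 1) ((a' : ℕ) : ℤ) (polarAngle p)) *
      (radialCutoffC (1 / 2) (momToComplex p) * ∑ b' ∈ S₂, sectorWeightCirc (m + 1) ((b' : ℕ) : ℤ) (polarAngle p))) :=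
    fun p => by rw [hZdef]
  obtain ⟨Φ, hΦdef⟩ : ∃ Φ : ℝ × (Fin 2 → ℝ) → ℂ, Φ = fun y => (((bgmCutoffSq e₀ ((16 : ℝ) ^ m * (y.1 ^ 2 + (frameLevel μ K (WithLp.toLp 2 y.2) - ν y.2) ^ 2)) -
      bgmCutoffSq e₀ ((16 : ℝ) ^ m * (y.1 ^ 2 + frameLevel μ K (WithLp.toLp 2 y.2) ^ 2))) *
      (bgmCutoffSq e₀ ((16 : ℝ) ^ m * (y.1 ^ 2 + frameLevel μ K (WithLp.toLp 2 y.2) ^ 2)) * Z y.2) : ℝ) : ℂ) := ⟨_, rfl⟩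
  have hΦ : ∀ k₀ p, Φ (k₀, p) = (((bgmCutoffSq e₀ ((16 : ℝ) ^ m * (k₀ ^ 2 + (frameLevel μ K (WithLp.toLp 2 p) - ν p) ^ 2)) -
      bgmCutoffSq e₀ ((16 : ℝ) ^ m * (k₀ ^ 2 + frameLevel μ K (WithLp.toLp 2 p) ^ 2))) *
      (bgmCutoffSq e₀ ((16 : ℝ) ^ m * (k₀ ^ 2 + frameLevel μ K (WithLp.toLp 2 p) ^ 2)) * Z p) : ℝ) : ℂ) := fun k₀ p => by rw [hΦdef]
  have hGsΦ : ∀ q, Gs q = Φ (π * (1 - 2 * M) / β + 2 * π / β * (((q.1 0).val : ℕ) : ℝ), fun j => 2 * π / L * (((q.2 j).valMinAbs : ℤ) : ℝ)) := by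
    intro q'; rw [hGsdef]
    subst hS₁ hS₂
    exact bgmFatIncr_mul_bgmFat_eq_symbol Ko hA he hz h3 m ω ω' hZ hν hΦ q'
  -- the time instance, exact brackets
  have htime := fun q => norm_fwdDiff_iter_time_fatIncrPair_le he hβ m hS₁r hS₂r hd1 hd2 hd3 hd4 hZ hN₀ hΦ hGsΦ hMm
    rfl rfl rfl rfl rfl rfl rfl rfl rfl rfl rfl rfl rfl rfl rfl q
  -- relative to the amplitude
  have hκ0 : 0 ≤ κ := by rw [hκ]; positivity
  have hqt₁0 : 0 ≤ qt₁ := by rw [hqt₁]; positivity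
  have hqt₂0 : 0 ≤ qt₂ := by rw [hqt₂]; positivity
  have hqt₃0 : 0 ≤ qt₃ := by rw [hqt₃]; positivity
  have hDt₁0 : 0 ≤ Dt₁ := by rw [hDt₁]; positivity
  have hDt₂0 : 0 ≤ Dt₂ := by rw [hDt₂]; positivity
  have hθ₁0 : 0 ≤ θ₁ := by rw [hθ₁]; positivity
  have hθ₂0 : 0 ≤ θ₂ := by rw [hθ₂]; positivity
  have hθ₃0 : 0 ≤ θ₃ := by rw [hθ₃]; positivity
  have hrel : ∀ q, ‖fwdDiff ((fun _ : Fin 1 => (1 : ZMod (2 * M))), (0 : TorusSite 2 L)) Gs q‖ ≤ B₀x * θ₁ ∧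
      ‖(fwdDiff ((fun _ : Fin 1 => (1 : ZMod (2 * M))), (0 : TorusSite 2 L)))^[2] Gs q‖ ≤ B₀x * θ₂ ∧
      ‖(fwdDiff ((fun _ : Fin 1 => (1 : ZMod (2 * M))), (0 : TorusSite 2 L)))^[3] Gs q‖ ≤ B₀x * θ₃ := by
    intro q
    obtain ⟨t₁, t₂, t₃⟩ := htime q
    have h := incrPair_time_rel_le (κ := κ) (C₁ := d * e₀ ^ 2 / klScale e₀ m ^ 2) (C₂ := d * e₀ ^ 4 / klScale e₀ m ^ 4)
      (C₃ := d * e₀ ^ 6 / klScale e₀ m ^ 6) (C₄ := d * e₀ ^ 8 / klScale e₀ m ^ 8)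
      (W₀ := G₀ / x ^ 2 * (2 * (klScale e₀ m + G₀ / x ^ 2) + G₀ / x ^ 2)) (D₁ := 2 * klScale e₀ m * |2 * π / β|) (D₂ := 2 * (2 * π / β) ^ 2)
      (q₁ := 2 * (d * e₀ ^ 2) * |2 * π / β| / klScale e₀ m) (q₂ := (4 * (d * e₀ ^ 4) + 2 * (d * e₀ ^ 2)) * (2 * π / β) ^ 2 / klScale e₀ m ^ 2)
      (q₃ := (8 * (d * e₀ ^ 6) + 12 * (d * e₀ ^ 4)) * |2 * π / β| ^ 3 / klScale e₀ m ^ 3)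
      (by rw [hκ]; field_simp) (by rw [hκ]; field_simp) (by rw [hκ]; field_simp) rfl rfl rfl rfl t₁ t₂ t₃
      (θ₁ := θ₁) (θ₂ := θ₂) (θ₃ := θ₃) (by rw [hθ₁, hDt₁, hqt₁]) (by rw [hθ₂, hDt₁, hDt₂, hqt₁, hqt₂]) (by rw [hθ₃, hDt₁, hDt₂, hqt₁, hqt₂, hqt₃])
    rw [← hC₁, ← hB₀x] at h
    exact h
  exact ⟨fun q => (hsup q).trans (le_of_eq (by rw [hB₀x, hC₁])), hcount, hτE, fun q => (hrel q).1, fun q => (hrel q).2.1, fun q => (hrel q).2.2,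
    ⟨hθ₁0, hθ₂0, hθ₃0⟩⟩

end AmpTime

end Summit.HubbardSuperconductivity.HubbardSuperconductivity.Theorems.TorusFourierL2

end
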